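import Mathlib
import Summits.Ventures.PercRepro2.Defs
import Summits.Ventures.PercRepro2.Graph
import Summits.Ventures.PercRepro2.OneColourSwitch
import Summits.Ventures.PercRepro2.RegionHubSign
import Summits.Ventures.PercRepro2.SideSwitch
import Summits.Ventures.PercRepro2.TermSwitchDefs
import Summits.Ventures.PercRepro2.TermSwitchFibre
import Summits.Ventures.PercRepro2.TermSwitchM9
import Summits.Ventures.PercRepro2.TermSwitchRestrict
import Summits.Ventures.PercRepro2.M9NoPocketDefs
import Summits.Ventures.PercRepro2.M9PocketCubeDefs
import Summits.Ventures.PercRepro2.M9PocketCubeFibre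
import Summits.Ventures.PercRepro2.M9Unreached
import Summits.Ventures.PercRepro2.M9PocketRepWorld
import Summits.Ventures.PercRepro2.M9PocketRepInvariant

/-!
# The one-sided points of a pocket representative have non-positive sum (blind cell PercRepro2,
p3 g25, 2026-08-28; `proofs/P3-GENERALD.md` §6′)

In the vocabulary of the pocket cube (`M9PocketCubeDefs`): for a pocket representative `ρ₀`, the
sum over the legal points `x ∈ LegalP ρ₀` in which `d` lies in exactly one world of `{r, s}`
(the status-`A` and status-`B` points) of `σ_pq · σ_rs (assignX x ρ₀)` is non-positive
(`abSum_nonpos`).  Proof: the fibre `{ω ∈ DOneSet : repP ω = ρ₀}` is in bijection with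
`LegalP ρ₀` (`assignX` / `coordsP`, `M9PocketCubeFibre`), the one-sided points are the reached
`Sep ∧ DZero` colourings of the fibre (`reached_dzero_iff_pair`, the `{r, s}`-form of
`unreached_iff`), and those have non-positive sum by
`dzeroSignSumHP_repP_nonpos` (`M9PocketRepInvariant`).  This settles «A ≤ 0 for a general d»
(P3-CONJG §8(b)) in the form `A + B ≤ 0` per pocket representative; `A = B` by the colour flip.
Own work; std axioms.
-/

namespace Summit.Ventures.PercRepro2

namespace NoPocket

open Finset Classical RegionHub OneColourSwitch SideSwitch TermSwitch

variable {V : Type*} {E : Type*}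

section AB

variable [Fintype V] [DecidableEq V] [Fintype E] [DecidableEq E] {ends : E → Sym2 V}
  {p q r s d : V}

/-- The one-sided (status `A` or `B`) sum of a pocket representative: over its legal points with
`d` in exactly one world of `{r, s}`. -/
noncomputable def abSum (ends : E → Sym2 V) (p q r s d : V) (ρ₀ : Config E) : ℤ :=
  ∑ x ∈ LegalP ends p q r s d ρ₀,
    if (d ∈ K2 ends r s (assignX ends x ρ₀) ∨ d ∈ M2 ends r s (assignX ends x ρ₀)) ∧
        ¬ (d ∈ K2 ends r s (assignX ends x ρ₀) ∧ d ∈ M2 ends r s (assignX ends x ρ₀)) then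
      sigma ends (assignX ends x ρ₀) p q * sigma ends (assignX ends x ρ₀) r s else 0

/-- The kernel of the restricted terminal sum for the predicate «`d` reached and `repP = ρ₀`»,
as a function on colourings. -/
noncomputable def repKernel (ends : E → Sym2 V) (p q r s d : V) (ρ₀ : Config E) (ω : Config E) :
    ℤ :=
  if sep2 ends p q r s ω ∧ DOne ends r s d ω ∧
      (d ∈ K2 ends r s ω ∨ d ∈ M2 ends r s ω) ∧ ¬ (d ∈ K2 ends r s ω ∧ d ∈ M2 ends r s ω) ∧
      repP (ends := ends) d r s ω = ρ₀ then
    sigma ends ω p q * sigma ends ω r s else 0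

omit [Fintype V] [DecidableEq V] [Fintype E] [DecidableEq E] in
/-- `Sep ∧ DZero` with `d` reached is `Sep_H ∧ DZero_H ∧ d ∉ O_H` for `H = {r, s}` (the reached
counterpart of `unreached_iff`). -/
lemma reached_dzero_iff_pair (ω : Config E) :
    (sep2 ends p q r s ω ∧ DZero ends r s ω ∧ (d ∈ K2 ends r s ω ∨ d ∈ M2 ends r s ω)) ↔
      (sepH ends p q ({r, s} : Set V) ω ∧ DZeroH ends ({r, s} : Set V) ω ∧
        d ∉ OsetH ends ({r, s} : Set V) ω) := by
  constructor
  · rintro ⟨⟨⟨hpr, hps, hqr, hqs⟩, ⟨hpr', hps', hqr', hqs'⟩⟩, hD, hR⟩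
    refine ⟨⟨?_, ?_, ?_, ?_⟩, ?_, ?_⟩
    · rintro ⟨h, hh, hc⟩
      simp only [Set.mem_insert_iff, Set.mem_singleton_iff] at hh
      rcases hh with rfl | rfl
      · exact hpr (conn_symm hc)
      · exact hps (conn_symm hc)
    · rintro ⟨h, hh, hc⟩
      simp only [Set.mem_insert_iff, Set.mem_singleton_iff] at hh
      rcases hh with rfl | rfl
      · exact hqr (conn_symm hc)
      · exact hqs (conn_symm hc)
    · rintro ⟨h, hh, hc⟩
      simp only [Set.mem_insert_iff, Set.mem_singleton_iff] at hh
      rcases hh with rfl | rfl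
      · exact hpr' (conn_symm hc)
      · exact hps' (conn_symm hc)
    · rintro ⟨h, hh, hc⟩
      simp only [Set.mem_insert_iff, Set.mem_singleton_iff] at hh
      rcases hh with rfl | rfl
      · exact hqr' (conn_symm hc)
      · exact hqs' (conn_symm hc)
    · intro x hxH hxK hxM
      have hxr : x ≠ r := fun h => hxH (by rw [h]; simp)
      have hxs : x ≠ s := fun h => hxH (by rw [h]; simp)
      exact hD x hxr hxs hxK hxM
    · intro hO
      exact hO hR
  · rintro ⟨hsep, hD, hO⟩
    refine ⟨sep2_of_sepH (by simp) (by simp) hsep, ?_, ?_⟩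
    · intro x hxr hxs hxK
      have hxH : x ∉ ({r, s} : Set V) := by
        simp only [Set.mem_insert_iff, Set.mem_singleton_iff, not_or]
        exact ⟨hxr, hxs⟩
      exact not_mem_both_of_DZeroH (by simp) (by simp) hD hxH hxK
    · by_contra h
      exact hO (fun h' => h h')

omit [Fintype V] [DecidableEq V] [Fintype E] [DecidableEq E] in
/-- `Sep ∧ DOne`, `d` reached, `d` not doubly reached ⟺ `Sep ∧ DZero ∧ d` reached. -/
lemma one_sided_iff (hr : d ≠ r) (hs : d ≠ s) (ω : Config E) :
    (sep2 ends p q r s ω ∧ DOne ends r s d ω ∧ (d ∈ K2 ends r s ω ∨ d ∈ M2 ends r s ω) ∧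
        ¬ (d ∈ K2 ends r s ω ∧ d ∈ M2 ends r s ω)) ↔
      (sep2 ends p q r s ω ∧ DZero ends r s ω ∧ (d ∈ K2 ends r s ω ∨ d ∈ M2 ends r s ω)) := by
  constructor
  · rintro ⟨hsep, hD, hR, hnb⟩
    refine ⟨hsep, ?_, hR⟩
    intro x hxr hxs hxK hxM
    by_cases hxd : x = d
    · subst hxd
      exact hnb ⟨hxK, hxM⟩
    · exact hD x hxr hxs hxd hxK hxM
  · rintro ⟨hsep, hD, hR⟩
    exact ⟨hsep, fun x hxr hxs _ hxK => hD x hxr hxs hxK, hR, fun h => hD d hr hs h.1 h.2⟩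

/-- The one-sided sum of a pocket representative is the sum of the representative kernel over
all colourings (the fibre `repP = ρ₀` of `DOneSet` is in bijection with `LegalP ρ₀`). -/
lemma abSum_eq_sum_repKernel (hr : d ≠ r) (hs : d ≠ s) {ρ₀ : Config E}
    (hρ : ρ₀ ∈ RepP ends p q r s d) :
    abSum ends p q r s d ρ₀ = ∑ ω : Config E, repKernel ends p q r s d ρ₀ ω := by
  -- restrict the right side to the fibre
  have hsplit : ∑ ω : Config E, repKernel ends p q r s d ρ₀ ω =
      ∑ ω ∈ (DOneSet ends p q r s d).filter (fun ω => repP (ends := ends) d r s ω = ρ₀),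
        repKernel ends p q r s d ρ₀ ω := by
    unfold DOneSet
    rw [Finset.filter_filter, Finset.sum_filter]
    refine Finset.sum_congr rfl fun ω _ => ?_
    by_cases h : (sep2 ends p q r s ω ∧ DOne ends r s d ω) ∧ repP (ends := ends) d r s ω = ρ₀
    · rw [if_pos h]
    · rw [if_neg h]
      unfold repKernel
      rw [if_neg]
      rintro ⟨h1, h2, _, _, h5⟩
      exact h ⟨⟨h1, h2⟩, h5⟩
  rw [hsplit]
  unfold abSum
  refine Finset.sum_nbij' (fun x => assignX ends x ρ₀) (fun ω => coordsP (ends := ends) d r s ω)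
    ?_ ?_ ?_ ?_ ?_
  · intro x hx
    have hx' := mem_LegalP.1 hx
    exact Finset.mem_filter.2 ⟨hx'.2, repP_assignX hr hs hρ hx'.1⟩
  · intro ω hω
    obtain ⟨hω1, hω2⟩ := Finset.mem_filter.1 hω
    rw [mem_LegalP]
    have h1 := coordsP_mem_cubeP hr hs hω1
    rw [hω2] at h1
    refine ⟨h1, ?_⟩
    have h2 := assignX_coordsP_repP hr hs hω1
    rw [hω2] at h2
    rw [h2]
    exact hω1
  · intro x hx
    exact coordsP_assignX hr hs hρ (mem_LegalP.1 hx).1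
  · intro ω hω
    obtain ⟨hω1, hω2⟩ := Finset.mem_filter.1 hω
    have h2 := assignX_coordsP_repP hr hs hω1
    rw [hω2] at h2
    exact h2
  · intro x hx
    have hx' := mem_LegalP.1 hx
    have hD := mem_DOneSet.1 hx'.2
    have hrep := repP_assignX hr hs hρ hx'.1
    unfold repKernel
    by_cases h : (d ∈ K2 ends r s (assignX ends x ρ₀) ∨ d ∈ M2 ends r s (assignX ends x ρ₀)) ∧
        ¬ (d ∈ K2 ends r s (assignX ends x ρ₀) ∧ d ∈ M2 ends r s (assignX ends x ρ₀))
    · rw [if_pos h, if_pos ⟨hD.1, hD.2, h.1, h.2, hrep⟩]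
    · rw [if_neg h, if_neg (fun h' => h ⟨h'.2.2.1, h'.2.2.2.1⟩)]

/-- **The one-sided points of a pocket representative have non-positive sum**:
`A + B ≤ 0` per pocket representative (and `A = B` by the colour flip). -/
theorem abSum_nonpos (hr : d ≠ r) (hs : d ≠ s) {ρ₀ : Config E} (hρ : ρ₀ ∈ RepP ends p q r s d) :
    abSum ends p q r s d ρ₀ ≤ 0 := by
  rw [abSum_eq_sum_repKernel hr hs hρ]
  have h := dzeroSignSumHP_repP_nonpos (ends := ends) (p := p) (q := q) hr hs ρ₀
  unfold dzeroSignSumHP at h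
  refine le_trans (le_of_eq ?_) h
  refine Finset.sum_congr rfl fun ω _ => ?_
  unfold repKernel
  by_cases hc : sep2 ends p q r s ω ∧ DOne ends r s d ω ∧
      (d ∈ K2 ends r s ω ∨ d ∈ M2 ends r s ω) ∧ ¬ (d ∈ K2 ends r s ω ∧ d ∈ M2 ends r s ω) ∧
      repP (ends := ends) d r s ω = ρ₀
  · rw [if_pos hc]
    have h1 := (reached_dzero_iff_pair (ends := ends) (p := p) (q := q) (d := d) ω).1
      ((one_sided_iff hr hs ω).1 ⟨hc.1, hc.2.1, hc.2.2.1, hc.2.2.2.1⟩)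
    rw [if_pos ⟨h1.1, h1.2.1, h1.2.2, hc.2.2.2.2⟩]
  · rw [if_neg hc]
    rw [if_neg]
    rintro ⟨h1, h2, h3, h4⟩
    have h5 := (one_sided_iff hr hs ω).2 ((reached_dzero_iff_pair (ends := ends) (p := p) (q := q)
      (d := d) ω).2 ⟨h1, h2, h3⟩)
    exact hc ⟨h5.1, h5.2.1, h5.2.2.1, h5.2.2.2, h4⟩

end AB

end NoPocket

end Summit.Ventures.PercRepro2
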